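import Summits.AtomisticToContinuum.Crystallization.Theorems.FrustratedLawDichotomyCellEflatData

/-!
# FrustratedLawDichotomy · crux `AperiodicFrustratedLawGap` (stmt-AtomisticToContinuum-27623) — E′♭₄₅ witness cell: class checks 8–11
# (decomp-a2c, prover hand 1, generation 15; kernel evaluations of `Cell.checkClass`, split for build time)

Each theorem is ONE `decide +kernel` of `cellE.checkClass m (cellECert m)`: nearest-neighbour and far witnesses, the square-root enclosure, the `±id`
hcp fit of the twelve assigned points, the full 11664-point scan (pinning + clean shell + assignment hits) and the class site-sum bound.  [folklore]
-/

namespace Summit.AtomisticToContinuum.Crystallization.Theorems.FrustratedLawDichotomyCellEflatCeiling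

open Summit.AtomisticToContinuum.Crystallization.Theorems.FrustratedLawDichotomyCellChecker


set_option maxHeartbeats 0 in
/-- Class `8` of `cellE` passes `checkClass` (kernel evaluation, ≈ 27 s). [folklore] -/
theorem cellE_checkClass8 : cellE.checkClass ⟨8, by decide⟩ (cellECert 8) = true := by decide +kernel

set_option maxHeartbeats 0 in
/-- Class `9` of `cellE` passes `checkClass` (kernel evaluation, ≈ 27 s). [folklore] -/
theorem cellE_checkClass9 : cellE.checkClass ⟨9, by decide⟩ (cellECert 9) = true := by decide +kernel

set_option maxHeartbeats 0 in
/-- Class `10` of `cellE` passes `checkClass` (kernel evaluation, ≈ 27 s). [folklore] -/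
theorem cellE_checkClass10 : cellE.checkClass ⟨10, by decide⟩ (cellECert 10) = true := by decide +kernel

set_option maxHeartbeats 0 in
/-- Class `11` of `cellE` passes `checkClass` (kernel evaluation, ≈ 27 s). [folklore] -/
theorem cellE_checkClass11 : cellE.checkClass ⟨11, by decide⟩ (cellECert 11) = true := by decide +kernel

end Summit.AtomisticToContinuum.Crystallization.Theorems.FrustratedLawDichotomyCellEflatCeiling
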